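import Mathlib.CategoryTheory.SingleObj
import Mathlib.CategoryTheory.Endomorphism
import Mathlib.CategoryTheory.Comma.Over.Basic
import Mathlib.Algebra.Order.Positive.Field
import Mathlib.Algebra.Order.Field.Rat
import Mathlib.Data.Finsupp.Basic
import Mathlib.Data.PNat.Basic
import Mathlib.Tactic.FieldSimp
import Mathlib.Tactic.Ring
import Literature.AlgebraicGeometry.Frobenioids.Categories
import Literature.AlgebraicGeometry.Frobenioids.ElementaryFrobenioid
import Literature.AlgebraicGeometry.Frobenioids.GroupLikeStandardExample
import Literature.AlgebraicGeometry.Frobenioids.RationalSemidirectBase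
import HarnessLib

/-!
# Frobenioids I, §4: Example 4.7 (ii) (Frobenius-slim vs. Div-slim) and Remark 4.11.2 (second half)

Mochizuki, *The geometry of Frobenioids I: the general theory*, Kyushu J. Math. **62** (2008)
293–400, kurims text pp. 87–88, 94 [cite: MochizukiFrdI2008, Ex. 4.7 (ii) pp.87-88].

**Example 4.7 (ii)** (DEFINED, facts PROVED): `V := ℚ`, `N := (N_{≥1})^gp` (positive rationals,
`RationalSemidirectBase.lean`), `G := V ⋊ N` "where `N (⊆ ℚ)` acts on `V` multiplicatively" —
`(v₁, n₁)(v₂, n₂) = (v₁ + n₁ v₂, n₁ n₂)`, a group; `D` the one-object category of `G`; "clearly there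
exists an injection `𝔽 ↪ G`" (`(a, d) ↦ (a, d)`, PROVED injective homomorphism) "so `D` fails to be
Frobenius-slim"; `Φ : D → Mon` "determined by the monoid `⨁_{g ∈ G} ℤ_{≥0}` … with the `G`-action
obtained by letting `G` act by left multiplication on the indices" — DEFINED as a genuine functor
`Dᵒᵖ ⥤ CommMonCat` with value `Multiplicative (G →₀ ℕ)` and `Φ(g)` = re-indexing along
`h ↦ g⁻¹ h` (the contravariant form of left multiplication, forced by `Φ` being a functor on `Dᵒᵖ`;
recorded); "the natural map `Aut(D_A → D) = G → Aut(D_A → Mon)` is clearly injective" — PROVED in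
the concrete form "`g ↦ Φ(g)` is injective" (`act_injective`), "so `D` is Div-slim [relative to `Φ`]".
**Remark 4.11.2, second half** (p. 94): "in Example 3.10, since `G = Aut(D_A → D)` acts trivially on
`ℤ_{≥0}`, it follows that `D` fails to be Div-slim" — the trivial action is `pull_trivialMonoidOn`
(`GroupLikeStandardExample.lean`), restated here for the one-object category of a group
(`Rmk4112.pull_eq_self`); the first half (Ex. 3.9: `U ⊆ G` acts trivially on `V × W`) is
`Ex39.act_inU` in `NonPreservationOfUnits.lean`.
**Deliberately NOT here** (vocabulary of seat abc-iut-L1-t3, not yet landed — TODO-merge): the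
conclusions "`D` is / is not Div-slim" ([FrdI] Def. 4.5 (iv), t3's `IsDivSlim`), "fails to be
Frobenius-slim" (Def. 3.1 (i), t3's `IsFrobeniusSlim`), "`Aut(D_A → D) ≅ G`" (typed as a named
statement), and Remark 4.12.1 (which is about t3's Example 3.10 objects and Cor. 4.12).
No statement of the paper is strengthened.
-/

namespace Literature.AlgebraicGeometry.Frobenioids

open CategoryTheory

namespace Ex47ii

open RatSemidirect (N natPos natPos_val natPos_injective)

/-- `G := V ⋊ N`, `V = ℚ`, "where `N (⊆ ℚ)` acts on `V` multiplicatively" (FrdI Ex. 4.7 (ii) p. 87).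
[cite: MochizukiFrdI2008, Ex. 4.7 (ii) p.87] -/
@[ext] structure G : Type where
  /-- the `V = ℚ` coordinate -/
  v : ℚ
  /-- the `N = ℚ_{>0}` coordinate -/
  n : N

namespace G

/-- The multiplication `(v₁, n₁) · (v₂, n₂) = (v₁ + n₁ v₂, n₁ n₂)` makes `G` a group (PROVED).
[cite: MochizukiFrdI2008, Ex. 4.7 (ii) p.87] -/
instance instGroup : Group G where
  mul x y := ⟨x.v + (x.n : ℚ) * y.v, x.n * y.n⟩
  one := ⟨0, 1⟩
  inv x := ⟨-((x.n : ℚ)⁻¹ * x.v), x.n⁻¹⟩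
  mul_assoc x y z := by
    refine G.ext ?_ (mul_assoc _ _ _)
    show x.v + (x.n : ℚ) * y.v + ((x.n * y.n : N) : ℚ) * z.v = x.v + (x.n : ℚ) * (y.v + (y.n : ℚ) * z.v)
    rw [Positive.val_mul]; ring
  one_mul x := by
    refine G.ext ?_ (one_mul _)
    show 0 + ((1 : N) : ℚ) * x.v = x.v
    simp [Positive.val_one]
  mul_one x := by
    refine G.ext ?_ (mul_one _)
    show x.v + (x.n : ℚ) * 0 = x.v
    simp
  inv_mul_cancel x := by
    refine G.ext ?_ (inv_mul_cancel _)
    show -((x.n : ℚ)⁻¹ * x.v) + ((x.n⁻¹ : N) : ℚ) * x.v = 0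
    rw [Positive.coe_inv]; ring

/-- Components of the product. [cite: MochizukiFrdI2008, Ex. 4.7 (ii) p.87] -/
@[simp] theorem mul_v (x y : G) : (x * y).v = x.v + (x.n : ℚ) * y.v := rfl

/-- Components of the product. [cite: MochizukiFrdI2008, Ex. 4.7 (ii) p.87] -/
@[simp] theorem mul_n (x y : G) : (x * y).n = x.n * y.n := rfl

/-- The unit. [cite: MochizukiFrdI2008, Ex. 4.7 (ii) p.87] -/
@[simp] theorem one_v : (1 : G).v = 0 := rfl

/-- The unit. [cite: MochizukiFrdI2008, Ex. 4.7 (ii) p.87] -/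
@[simp] theorem one_n : (1 : G).n = 1 := rfl

end G

/-- `D`: "a one-object category, `A ∈ Ob(D)`; suppose that `End_D(A) = G`" (FrdI p. 87).
[cite: MochizukiFrdI2008, Ex. 4.7 (ii) p.87] -/
abbrev D : Type := SingleObj G

/-- "Then clearly there exists an injection `𝔽 ↪ G`" (FrdI p. 87): `(a, d) ↦ (a, d)` (the law
`(a₁, d₁)(a₂, d₂) = (a₁ + d₁ a₂, d₁ d₂)` of `𝔽` is that of `G`). [cite: MochizukiFrdI2008, Ex. 4.7 (ii) p.87] -/
def frobToG : StandardFrobenioid →* G where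
  toFun x := ⟨(Multiplicative.toAdd x.div : ℕ), natPos x.degFr⟩
  map_one' := G.ext (by simp) (by simp)
  map_mul' x y := by
    refine G.ext ?_ ?_
    · show ((Multiplicative.toAdd (x * y).div : ℕ) : ℚ) =
        (Multiplicative.toAdd x.div : ℕ) + ((natPos x.degFr : N) : ℚ) * (Multiplicative.toAdd y.div : ℕ)
      simp only [ElemFrobenioidMonoid.mul_div, toAdd_mul, toAdd_pow, smul_eq_mul, Nat.cast_add,
        Nat.cast_mul, natPos_val]
    · show natPos (x * y).degFr = natPos x.degFr * natPos y.degFr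
      rw [ElemFrobenioidMonoid.mul_degFr, map_mul]

/-- The injection `𝔽 ↪ G` is injective ("… so `D` fails to be Frobenius-slim" — the conclusion is
[FrdI] Def. 3.1 (i), seat abc-iut-L1-t3). [cite: MochizukiFrdI2008, Ex. 4.7 (ii) p.87] -/
theorem frobToG_injective : Function.Injective frobToG := by
  intro x y h
  have hv := congrArg G.v h
  have hn := congrArg G.n h
  change ((Multiplicative.toAdd x.div : ℕ) : ℚ) = (Multiplicative.toAdd y.div : ℕ) at hv
  change natPos x.degFr = natPos y.degFr at hn
  refine ElemFrobenioidMonoid.ext ?_ (natPos_injective hn)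
  have hv' : (Multiplicative.toAdd x.div : ℕ) = Multiplicative.toAdd y.div := by exact_mod_cast hv
  exact Multiplicative.toAdd.injective hv'

/-- The action on `⨁_{g ∈ G} ℤ_{≥0}` (= finitely supported functions `G →₀ ℕ`, written multiplicatively)
"obtained by letting `G` act by left multiplication on the indices of the copies of `ℤ_{≥0}`"
(FrdI p. 87): as the pull-back `Φ(g)` along `g` we take re-indexing by `h ↦ g⁻¹ · h` (the contravariant
form; `Φ(g g') = Φ(g') ∘ Φ(g)`). [cite: MochizukiFrdI2008, Ex. 4.7 (ii) p.87] -/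
noncomputable def act (g : G) : Multiplicative (G →₀ ℕ) →* Multiplicative (G →₀ ℕ) :=
  AddMonoidHom.toMultiplicative (Finsupp.mapDomain.addMonoidHom fun h => g⁻¹ * h)

/-- Values of the action. [cite: MochizukiFrdI2008, Ex. 4.7 (ii) p.87] -/
theorem toAdd_act (g : G) (x : Multiplicative (G →₀ ℕ)) :
    Multiplicative.toAdd (act g x) = Finsupp.mapDomain (fun h => g⁻¹ * h) (Multiplicative.toAdd x) :=
  rfl

/-- `Φ(g g') = Φ(g') ∘ Φ(g)` (contravariance). [cite: MochizukiFrdI2008, Ex. 4.7 (ii) p.87] -/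
theorem act_mul (g g' : G) : act (g * g') = (act g').comp (act g) := by
  refine MonoidHom.ext fun x => Multiplicative.toAdd.injective ?_
  simp only [toAdd_act, MonoidHom.coe_comp, Function.comp_apply]
  rw [← Finsupp.mapDomain_comp]
  congr 1
  funext h
  simp [mul_assoc, mul_inv_rev]

/-- `Φ(1) = id`. [cite: MochizukiFrdI2008, Ex. 4.7 (ii) p.87] -/
theorem act_one : act 1 = MonoidHom.id _ := by
  refine MonoidHom.ext fun x => Multiplicative.toAdd.injective ?_
  simp only [toAdd_act, inv_one, one_mul, MonoidHom.id_apply]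
  exact Finsupp.mapDomain_id

/-- `Φ : D → Mon`, "the functor determined by the monoid `⨁_{g∈G} ℤ_{≥0}` … equipped with the
`G`-action" (FrdI p. 87), as a functor `Dᵒᵖ ⥤ CommMonCat`. [cite: MochizukiFrdI2008, Ex. 4.7 (ii) p.87] -/
noncomputable def Φ : Dᵒᵖ ⥤ CommMonCat.{0} where
  obj _ := CommMonCat.of (Multiplicative (G →₀ ℕ))
  map f := CommMonCat.ofHom (act (show G from f.unop))
  map_id A := by
    refine CommMonCat.hom_ext (MonoidHom.ext fun x => ?_)
    change act 1 x = x
    rw [act_one]; rfl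
  map_comp f g := by
    refine CommMonCat.hom_ext (MonoidHom.ext fun x => ?_)
    change act ((show G from f.unop) * (show G from g.unop)) x = act _ (act _ x)
    rw [act_mul]; rfl

/-- "the natural map `Aut(D_A → D) = G → Aut(D_A → Mon)` is clearly injective" (FrdI pp. 87–88), in
the concrete form: the action `g ↦ Φ(g)` is injective (`Φ(g)` sends the generator indexed by `1` to
the one indexed by `g⁻¹`; PROVED) — "so `D` is Div-slim [relative to `Φ`]" ([FrdI] Def. 4.5 (iv),
seat abc-iut-L1-t3). [cite: MochizukiFrdI2008, Ex. 4.7 (ii) p.88] -/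
theorem act_injective : Function.Injective act := by
  intro g g' h
  have h1 := congrArg (fun φ => Multiplicative.toAdd (φ (Multiplicative.ofAdd (Finsupp.single 1 1)))) h
  simp only [toAdd_act, toAdd_ofAdd, Finsupp.mapDomain_single, mul_one] at h1
  have h2 : g⁻¹ = g'⁻¹ := by
    by_contra hne
    have := congrArg (fun f : G →₀ ℕ => f g⁻¹) h1
    simp [Ne.symm hne] at this
  exact inv_injective h2

/-- "`End_D(A) = G` [so `Aut(D_A → D) = G`]" (FrdI p. 87) — named statement.
[cite: MochizukiFrdI2008, Ex. 4.7 (ii) p.87] -/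
def AutForgetIsoG : Prop := Nonempty (Aut (Over.forget (SingleObj.star G)) ≃* G)

end Ex47ii

/-! ### Remark 4.11.2, second half: the base of Example 3.10 -/

namespace Rmk4112

/-- "in Example 3.10, since `G = Aut(D_A → D)` [where `A ∈ Ob(D)`] acts trivially on `ℤ_{≥0}`, it
follows that `D` fails to be Div-slim" (FrdI Rem. 4.11.2 p. 94): the triviality of the action of the
monoid of Ex. 3.10 (the trivial monoid `ℤ_{≥0}` on the one-object category of a group `G`,
`trivialMonoidOn`) is definitional (PROVED); the conclusion is Def. 4.5 (iv) vocabulary (seat t3).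
[cite: MochizukiFrdI2008, Rem. 4.11.2 p.94] -/
theorem pull_eq_self (G : Type) [Group G] {A B : SingleObj G} (f : B ⟶ A) (v : Multiplicative ℕ) :
    pull (trivialMonoidOn G (Multiplicative ℕ)) f v = v :=
  rfl

end Rmk4112

/-! ### Addendum (referee PASS-C2, C2-Fb): the two renderings of `ℚ ⋊ N` -/

/-- Clarification (ref-c C2-Fb): the group `G = U ⋊ N` of Examples 3.8/3.9 ("`n` acts on `U` by
`n⁻¹`", `RationalSemidirectBase.lean`) and the group `G = V ⋊ N` of Example 4.7 (ii) ("`N (⊆ ℚ)` acts on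
`V` multiplicatively", p. 87 ll.34–41; `Ex47ii.G`) are identified by the `N`-inverting isomorphism
`(u, n) ↦ (u, n⁻¹)` (PROVED). [cite: MochizukiFrdI2008, Ex. 4.7 (ii) p.87] -/
def Ex47ii.equivRatSemidirect : RatSemidirect.G ≃* Ex47ii.G where
  toFun x := ⟨x.u, x.n⁻¹⟩
  invFun y := ⟨y.v, y.n⁻¹⟩
  left_inv x := by simp
  right_inv y := by simp
  map_mul' x y := by
    refine Ex47ii.G.ext ?_ ?_
    · show (x * y).u = x.u + ((x.n⁻¹ : RatSemidirect.N) : ℚ) * y.u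
      rw [RatSemidirect.G.mul_u, Positive.coe_inv]
    · show (x * y).n⁻¹ = x.n⁻¹ * y.n⁻¹
      rw [RatSemidirect.G.mul_n, mul_inv]

end Literature.AlgebraicGeometry.Frobenioids
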